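import Mathlib
import Summits.CriticalPhenomena.PercolationContinuityZ3.Theorems.PercNearOneGluingNoHeavyLowerTailOrderedDifferencesComplementPair

/-!
# Product families: the pencil spectrum is multiplicative, and CONJECTURE J reduces to `θ = −1`

Helper file for crux `stmt-CriticalPhenomena-4575` (`NoHeavyLowerTail`, route `PercNearOneGluingNoHeavy`), new-inequality factory
seat `prim-ineq-gen-3` (gen 31).  Everything here is PROVED; no definitions.  Imports Mathlib and `…OrderedDifferencesComplementPair`
(`diffs_subset_of_subset`, `subset_compl_iff_and_disjoint_compl_iff`).  Memo: `run/shared/lean/prim/prim-ineq-gen-3/FINDINGS-gen31.md`.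

For finite families `𝒜` (on `α`) and `ℬ` (on `β`) the PRODUCT FAMILY on `α ⊕ β` is `𝒜 ⊗ ℬ = {a ⊔ b : a ∈ 𝒜, b ∈ ℬ}`
(`(𝒜 ×ˢ ℬ).image fun p => p.1.disjSum p.2`).  Its difference set is the product of the difference sets
(`diffs_prodFamily`: `(𝒜 ⊗ ℬ) \\ (𝒜 ⊗ ℬ) = (𝒜 \\ 𝒜) ⊗ (ℬ \\ ℬ)`), and containment / disjointness of `E₁ ⊔ E₂` with `a ⊔ b`
factor, so the two incidence matrices `Z = [E ⊆ A]`, `Y = [E ∩ A = ∅]` of `𝒜 ⊗ ℬ` are the Kronecker products of those of `𝒜` and `ℬ`.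
Consequences for the Marica–Schönheim pencil `U(θ) = Z + θY` (rows `A ↦ (E ↦ [E ⊆ A] + θ [E ∩ A = ∅])`, `E ∈ 𝒜 \\ 𝒜`):

* `pencil_dependency_prod` — ★ EIGENVALUES MULTIPLY: a left kernel vector `c` of `U_𝒜(θ₁)` and `d` of `U_ℬ(θ₂)` give the left kernel
  vector `c ⊗ d` (`P ↦ c P.toLeft * d P.toRight`) of `U_{𝒜⊗ℬ}(−θ₁θ₂)`.
* `pencil_chain_prod` — ★ JORDAN CHAINS MULTIPLY: a left Jordan chain `(c₀, c₁)` of length two at `θ₁` for `𝒜`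
  (`c₀ U(θ₁) = 0`, `c₁ U(θ₁) + c₀ Y = 0`) and a kernel vector `d` at `θ₂ ≠ 0` for `ℬ` give the chain
  `(c₀ ⊗ d, −θ₂⁻¹ • c₁ ⊗ d)` at `−θ₁θ₂` for `𝒜 ⊗ ℬ`.
* `pencil_dependency_signFlip`, `not_linearIndependent_pencil_neg_of_not_linearIndependent` — ★ with the two-member family
  `{∅, {⋆}}` on `Unit` (kernel vector `(1, −1)` at `θ = 1`): a dependency at `t` for `𝒜` gives one at `−t` for `𝒜 ⊗ {∅, {⋆}}`;
  so the MS-PENCIL CONJECTURE (C0) at `t` for all families is EQUIVALENT to (C0) at `−t` for all families, and the set of bad values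
  `{t : some family has dependent pencil rows at t}` is closed under `t ↦ −t`, `t ↦ t⁻¹` (complementation, `pencil_dependency_compl`)
  and `(t₁, t₂) ↦ −t₁t₂`: together with `±1` it is a multiplicative GROUP.
* `pencil_dependency_compl` — `𝒜ᶜ = {S \ A}` has the same difference set and the kernel vector `S \ A ↦ c A` at `θ⁻¹`.
* `pencil_chain_neg_one_of_chain` — ★★ a left Jordan chain of length two at ANY `θ ≠ 0` for `𝒜` produces one at `θ = −1` for
  `𝒜 ⊗ 𝒜ᶜ` (on `α ⊕ α`).  Hence CONJECTURE J ('the pencil is semisimple at every eigenvalue, over every field of characteristic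
  `≠ 2`', memo `CONJECTURE-J.md`) is EQUIVALENT to its single case `θ = −1` ('`Z − Y` carries no Jordan chain'), uniformly over any
  field; likewise (sign flip) to its case `θ = +1`.
(prim-ineq-gen-3 gen 31, 2026-08-26.)
-/

namespace Summit.CriticalPhenomena.PercolationContinuityZ3.Theorems

namespace OrderedDifferences

open Finset
open scoped FinsetFamily

variable {α β : Type*}

/-! ### Finsets over a sum type: splitting containment and disjointness -/

/-- `a ⊔ b ⊆ a' ⊔ b'` iff `a ⊆ a'` and `b ⊆ b'`. -/
theorem disjSum_subset_disjSum_iff (a a' : Finset α) (b b' : Finset β) :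
    a.disjSum b ⊆ a'.disjSum b' ↔ a ⊆ a' ∧ b ⊆ b' := by
  rw [disjSum_subset, toLeft_disjSum, toRight_disjSum]

/-- `a ⊔ b` and `a' ⊔ b'` are disjoint iff `a, a'` are and `b, b'` are. -/
theorem disjoint_disjSum_disjSum_iff (a a' : Finset α) (b b' : Finset β) :
    Disjoint (a.disjSum b) (a'.disjSum b') ↔ Disjoint a a' ∧ Disjoint b b' := by
  simp only [disjoint_left, mem_disjSum]
  constructor
  · intro h
    refine ⟨fun x hx hx' => h (Or.inl ⟨x, hx, rfl⟩) (Or.inl ⟨x, hx', rfl⟩),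
      fun y hy hy' => h (Or.inr ⟨y, hy, rfl⟩) (Or.inr ⟨y, hy', rfl⟩)⟩
  · rintro ⟨h1, h2⟩ z hz hz'
    rcases hz with ⟨x, hx, rfl⟩ | ⟨y, hy, rfl⟩
    · rcases hz' with ⟨x', hx', hxx'⟩ | ⟨y', _, hyy'⟩
      · exact h1 hx (by cases hxx'; exact hx')
      · cases hyy'
    · rcases hz' with ⟨x', _, hxx'⟩ | ⟨y', hy', hyy'⟩
      · cases hxx'
      · exact h2 hy (by cases hyy'; exact hy')

/-- `p ↦ p.1 ⊔ p.2` is injective. -/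
theorem injective_disjSum_uncurry :
    Function.Injective (fun p : Finset α × Finset β => p.1.disjSum p.2) := by
  rintro ⟨a, b⟩ ⟨a', b'⟩ h
  dsimp only at h
  obtain ⟨h1, h2⟩ := disjSum_inj.mp h
  rw [h1, h2]

variable [DecidableEq α] [DecidableEq β] {K : Type*} [Field K]

/-- `(a ⊔ b) \ (a' ⊔ b') = (a \ a') ⊔ (b \ b')`. -/
theorem disjSum_sdiff_disjSum (a a' : Finset α) (b b' : Finset β) :
    a.disjSum b \ a'.disjSum b' = (a \ a').disjSum (b \ b') := by
  rw [eq_disjSum_iff, toLeft_sdiff, toRight_sdiff, toLeft_disjSum, toLeft_disjSum, toRight_disjSum, toRight_disjSum]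
  exact ⟨rfl, rfl⟩

/-! ### The product family `𝒜 ⊗ ℬ = {a ⊔ b}` -/

/-- Membership in the product family: `P ∈ 𝒜 ⊗ ℬ ↔ P.toLeft ∈ 𝒜 ∧ P.toRight ∈ ℬ`. -/
theorem mem_prodFamily_iff (𝒜 : Finset (Finset α)) (ℬ : Finset (Finset β)) (P : Finset (α ⊕ β)) :
    P ∈ (𝒜 ×ˢ ℬ).image (fun p => p.1.disjSum p.2) ↔ P.toLeft ∈ 𝒜 ∧ P.toRight ∈ ℬ := by
  rw [mem_image]
  constructor
  · rintro ⟨⟨a, b⟩, hp, rfl⟩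
    rw [mem_product] at hp
    simpa using hp
  · rintro ⟨h1, h2⟩
    exact ⟨(P.toLeft, P.toRight), mem_product.mpr ⟨h1, h2⟩, toLeft_disjSum_toRight⟩

/-- **The difference set of a product family is the product of the difference sets.** -/
theorem diffs_prodFamily (𝒜 : Finset (Finset α)) (ℬ : Finset (Finset β)) :
    ((𝒜 ×ˢ ℬ).image (fun p => p.1.disjSum p.2)) \\ ((𝒜 ×ˢ ℬ).image (fun p => p.1.disjSum p.2)) =
      ((𝒜 \\ 𝒜) ×ˢ (ℬ \\ ℬ)).image (fun p => p.1.disjSum p.2) := by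
  ext E
  rw [mem_diffs, mem_image]
  constructor
  · rintro ⟨P, hP, Q, hQ, rfl⟩
    obtain ⟨⟨a, b⟩, hab, rfl⟩ := mem_image.mp hP
    obtain ⟨⟨a', b'⟩, hab', rfl⟩ := mem_image.mp hQ
    rw [mem_product] at hab hab'
    refine ⟨(a \ a', b \ b'), mem_product.mpr ⟨?_, ?_⟩, ?_⟩
    · exact mem_diffs.mpr ⟨a, hab.1, a', hab'.1, rfl⟩
    · exact mem_diffs.mpr ⟨b, hab.2, b', hab'.2, rfl⟩
    · exact (disjSum_sdiff_disjSum a a' b b').symm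
  · rintro ⟨⟨E₁, E₂⟩, hE, rfl⟩
    rw [mem_product] at hE
    obtain ⟨a, ha, a', ha', rfl⟩ := mem_diffs.mp hE.1
    obtain ⟨b, hb, b', hb', rfl⟩ := mem_diffs.mp hE.2
    refine ⟨a.disjSum b, ?_, a'.disjSum b', ?_, disjSum_sdiff_disjSum a a' b b'⟩
    · exact mem_image.mpr ⟨(a, b), mem_product.mpr ⟨ha, hb⟩, rfl⟩
    · exact mem_image.mpr ⟨(a', b'), mem_product.mpr ⟨ha', hb'⟩, rfl⟩

/-- Sums over the product family are double sums. -/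
theorem sum_prodFamily (𝒜 : Finset (Finset α)) (ℬ : Finset (Finset β)) (f : Finset (α ⊕ β) → K) :
    ∑ P ∈ (𝒜 ×ˢ ℬ).image (fun p => p.1.disjSum p.2), f P = ∑ A ∈ 𝒜, ∑ B ∈ ℬ, f (A.disjSum B) := by
  rw [sum_image (fun p _ q _ h => injective_disjSum_uncurry h), sum_product]

/-- The pencil row entry of a product member at a product column factors:
`[E₁ ⊔ E₂ ⊆ a ⊔ b] + θ [E₁ ⊔ E₂ ∩ (a ⊔ b) = ∅] = [E₁ ⊆ a][E₂ ⊆ b] + θ [E₁ ∩ a = ∅][E₂ ∩ b = ∅]`. -/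
theorem pencil_entry_disjSum (E₁ a : Finset α) (E₂ b : Finset β) (θ : K) :
    ((if E₁.disjSum E₂ ⊆ a.disjSum b then (1 : K) else 0) +
        θ * (if Disjoint (E₁.disjSum E₂) (a.disjSum b) then (1 : K) else 0)) =
      (if E₁ ⊆ a then (1 : K) else 0) * (if E₂ ⊆ b then (1 : K) else 0) +
        θ * ((if Disjoint E₁ a then (1 : K) else 0) * (if Disjoint E₂ b then (1 : K) else 0)) := by
  simp only [disjSum_subset_disjSum_iff, disjoint_disjSum_disjSum_iff]
  by_cases h1 : E₁ ⊆ a <;> by_cases h2 : E₂ ⊆ b <;> by_cases h3 : Disjoint E₁ a <;> by_cases h4 : Disjoint E₂ b <;>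
    simp [h1, h2, h3, h4]

/-- Splitting a pencil row sum into its `Z`-part and its `Y`-part. -/
theorem pencil_sum_eq_add (𝒜 : Finset (Finset α)) (c : Finset α → K) (θ : K) (E : Finset α) :
    ∑ A ∈ 𝒜, c A * ((if E ⊆ A then (1 : K) else 0) + θ * (if Disjoint E A then (1 : K) else 0)) =
      (∑ A ∈ 𝒜, c A * (if E ⊆ A then (1 : K) else 0)) + θ * ∑ A ∈ 𝒜, c A * (if Disjoint E A then (1 : K) else 0) := by
  rw [mul_sum, ← sum_add_distrib]
  refine sum_congr rfl fun A _ => ?_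
  ring

/-- The double sum of a tensor `c A * d B` against a factored entry factors. -/
theorem sum_sum_tensor_pencil (𝒜 : Finset (Finset α)) (ℬ : Finset (Finset β)) (c : Finset α → K) (d : Finset β → K)
    (E₁ : Finset α) (E₂ : Finset β) (θ : K) :
    ∑ A ∈ 𝒜, ∑ B ∈ ℬ, c A * d B *
        ((if E₁.disjSum E₂ ⊆ A.disjSum B then (1 : K) else 0) +
          θ * (if Disjoint (E₁.disjSum E₂) (A.disjSum B) then (1 : K) else 0)) =
      (∑ A ∈ 𝒜, c A * (if E₁ ⊆ A then (1 : K) else 0)) * (∑ B ∈ ℬ, d B * (if E₂ ⊆ B then (1 : K) else 0)) +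
        θ * ((∑ A ∈ 𝒜, c A * (if Disjoint E₁ A then (1 : K) else 0)) *
          (∑ B ∈ ℬ, d B * (if Disjoint E₂ B then (1 : K) else 0))) := by
  simp_rw [pencil_entry_disjSum, sum_mul_sum, mul_sum, ← sum_add_distrib]
  refine sum_congr rfl fun A _ => sum_congr rfl fun B _ => ?_
  ring

/-! ### Eigenvalues and Jordan chains multiply -/

/-- **Eigenvalues multiply.**  If `c` is a left kernel vector of the pencil of `𝒜` at `θ₁` and `d` one of the pencil of `ℬ` at `θ₂`
(on the respective difference sets), then `P ↦ c P.toLeft * d P.toRight` is a left kernel vector of the pencil of the product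
family at `−θ₁θ₂`. -/
theorem pencil_dependency_prod (𝒜 : Finset (Finset α)) (ℬ : Finset (Finset β)) (c : Finset α → K) (d : Finset β → K)
    {θ₁ θ₂ : K}
    (hc : ∀ E ∈ 𝒜 \\ 𝒜, ∑ A ∈ 𝒜, c A * ((if E ⊆ A then (1 : K) else 0) + θ₁ * (if Disjoint E A then (1 : K) else 0)) = 0)
    (hd : ∀ E ∈ ℬ \\ ℬ, ∑ B ∈ ℬ, d B * ((if E ⊆ B then (1 : K) else 0) + θ₂ * (if Disjoint E B then (1 : K) else 0)) = 0) :
    ∀ E ∈ ((𝒜 ×ˢ ℬ).image (fun p => p.1.disjSum p.2)) \\ ((𝒜 ×ˢ ℬ).image (fun p => p.1.disjSum p.2)),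
      ∑ P ∈ (𝒜 ×ˢ ℬ).image (fun p => p.1.disjSum p.2), (c P.toLeft * d P.toRight) *
        ((if E ⊆ P then (1 : K) else 0) + (-(θ₁ * θ₂)) * (if Disjoint E P then (1 : K) else 0)) = 0 := by
  intro E hE
  rw [diffs_prodFamily] at hE
  obtain ⟨⟨E₁, E₂⟩, hE12, rfl⟩ := mem_image.mp hE
  rw [mem_product] at hE12
  rw [sum_prodFamily]
  simp only [toLeft_disjSum, toRight_disjSum]
  rw [sum_sum_tensor_pencil]
  have h1 := hc E₁ hE12.1
  have h2 := hd E₂ hE12.2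
  rw [pencil_sum_eq_add] at h1 h2
  -- `zc = -θ₁ yc`, `zd = -θ₂ yd`
  linear_combination (∑ B ∈ ℬ, d B * (if E₂ ⊆ B then (1 : K) else 0)) * h1 -
    (θ₁ * ∑ A ∈ 𝒜, c A * (if Disjoint E₁ A then (1 : K) else 0)) * h2

/-- **Jordan chains multiply.**  A left Jordan chain `(c₀, c₁)` of length two at `θ₁` for `𝒜` (`c₀ U(θ₁) = 0`,
`c₁ U(θ₁) + c₀ Y = 0`) and a left kernel vector `d` at `θ₂ ≠ 0` for `ℬ` give the left Jordan chain
`(c₀ ⊗ d, −θ₂⁻¹ c₁ ⊗ d)` of length two at `−θ₁θ₂` for the product family. -/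
theorem pencil_chain_prod (𝒜 : Finset (Finset α)) (ℬ : Finset (Finset β)) (c₀ c₁ : Finset α → K) (d : Finset β → K)
    {θ₁ θ₂ : K} (hθ₂ : θ₂ ≠ 0)
    (hc₀ : ∀ E ∈ 𝒜 \\ 𝒜, ∑ A ∈ 𝒜, c₀ A * ((if E ⊆ A then (1 : K) else 0) + θ₁ * (if Disjoint E A then (1 : K) else 0)) = 0)
    (hc₁ : ∀ E ∈ 𝒜 \\ 𝒜, ∑ A ∈ 𝒜, (c₁ A * ((if E ⊆ A then (1 : K) else 0) + θ₁ * (if Disjoint E A then (1 : K) else 0)) +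
      c₀ A * (if Disjoint E A then (1 : K) else 0)) = 0)
    (hd : ∀ E ∈ ℬ \\ ℬ, ∑ B ∈ ℬ, d B * ((if E ⊆ B then (1 : K) else 0) + θ₂ * (if Disjoint E B then (1 : K) else 0)) = 0) :
    (∀ E ∈ ((𝒜 ×ˢ ℬ).image (fun p => p.1.disjSum p.2)) \\ ((𝒜 ×ˢ ℬ).image (fun p => p.1.disjSum p.2)),
      ∑ P ∈ (𝒜 ×ˢ ℬ).image (fun p => p.1.disjSum p.2), (c₀ P.toLeft * d P.toRight) *
        ((if E ⊆ P then (1 : K) else 0) + (-(θ₁ * θ₂)) * (if Disjoint E P then (1 : K) else 0)) = 0) ∧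
    (∀ E ∈ ((𝒜 ×ˢ ℬ).image (fun p => p.1.disjSum p.2)) \\ ((𝒜 ×ˢ ℬ).image (fun p => p.1.disjSum p.2)),
      ∑ P ∈ (𝒜 ×ˢ ℬ).image (fun p => p.1.disjSum p.2),
        ((-θ₂⁻¹ * (c₁ P.toLeft * d P.toRight)) *
          ((if E ⊆ P then (1 : K) else 0) + (-(θ₁ * θ₂)) * (if Disjoint E P then (1 : K) else 0)) +
        (c₀ P.toLeft * d P.toRight) * (if Disjoint E P then (1 : K) else 0)) = 0) := by
  refine ⟨pencil_dependency_prod 𝒜 ℬ c₀ d hc₀ hd, ?_⟩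
  intro E hE
  rw [diffs_prodFamily] at hE
  obtain ⟨⟨E₁, E₂⟩, hE12, rfl⟩ := mem_image.mp hE
  rw [mem_product] at hE12
  rw [sum_prodFamily]
  simp only [toLeft_disjSum, toRight_disjSum]
  -- split the summand into the `c₁ ⊗ d` row part and the `c₀ ⊗ d` `Y`-part
  have eY : ∀ (A : Finset α) (B : Finset β), (if Disjoint (E₁.disjSum E₂) (A.disjSum B) then (1 : K) else 0) =
      (if Disjoint E₁ A then (1 : K) else 0) * (if Disjoint E₂ B then (1 : K) else 0) := by
    intro A B
    simp only [disjoint_disjSum_disjSum_iff]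
    by_cases h3 : Disjoint E₁ A <;> by_cases h4 : Disjoint E₂ B <;> simp [h3, h4]
  have split : ∑ A ∈ 𝒜, ∑ B ∈ ℬ,
      ((-θ₂⁻¹ * (c₁ A * d B)) *
          ((if E₁.disjSum E₂ ⊆ A.disjSum B then (1 : K) else 0) +
            (-(θ₁ * θ₂)) * (if Disjoint (E₁.disjSum E₂) (A.disjSum B) then (1 : K) else 0)) +
        (c₀ A * d B) * (if Disjoint (E₁.disjSum E₂) (A.disjSum B) then (1 : K) else 0)) =
      -θ₂⁻¹ * (∑ A ∈ 𝒜, ∑ B ∈ ℬ, c₁ A * d B *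
          ((if E₁.disjSum E₂ ⊆ A.disjSum B then (1 : K) else 0) +
            (-(θ₁ * θ₂)) * (if Disjoint (E₁.disjSum E₂) (A.disjSum B) then (1 : K) else 0))) +
        (∑ A ∈ 𝒜, c₀ A * (if Disjoint E₁ A then (1 : K) else 0)) *
          (∑ B ∈ ℬ, d B * (if Disjoint E₂ B then (1 : K) else 0)) := by
    rw [mul_sum, sum_mul_sum, ← sum_add_distrib]
    refine sum_congr rfl fun A _ => ?_
    rw [mul_sum, ← sum_add_distrib]
    refine sum_congr rfl fun B _ => ?_
    rw [eY]
    ring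
  rw [split, sum_sum_tensor_pencil]
  have h0 := hc₀ E₁ hE12.1
  have h2 := hd E₂ hE12.2
  have h1 := hc₁ E₁ hE12.1
  rw [pencil_sum_eq_add] at h0 h2
  have h1' : (∑ A ∈ 𝒜, c₁ A * (if E₁ ⊆ A then (1 : K) else 0)) +
      θ₁ * (∑ A ∈ 𝒜, c₁ A * (if Disjoint E₁ A then (1 : K) else 0)) +
      ∑ A ∈ 𝒜, c₀ A * (if Disjoint E₁ A then (1 : K) else 0) = 0 := by
    rw [← pencil_sum_eq_add, ← sum_add_distrib]
    exact h1
  set zc0 := ∑ A ∈ 𝒜, c₀ A * (if E₁ ⊆ A then (1 : K) else 0)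
  set yc0 := ∑ A ∈ 𝒜, c₀ A * (if Disjoint E₁ A then (1 : K) else 0)
  set zc1 := ∑ A ∈ 𝒜, c₁ A * (if E₁ ⊆ A then (1 : K) else 0)
  set yc1 := ∑ A ∈ 𝒜, c₁ A * (if Disjoint E₁ A then (1 : K) else 0)
  set zd := ∑ B ∈ ℬ, d B * (if E₂ ⊆ B then (1 : K) else 0)
  set yd := ∑ B ∈ ℬ, d B * (if Disjoint E₂ B then (1 : K) else 0)
  have e2 : zd = -θ₂ * yd := by linear_combination h2
  have e1 : zc1 = -θ₁ * yc1 - yc0 := by linear_combination h1'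
  rw [e1, e2]
  field_simp
  ring

/-! ### The sign flip `t ↦ −t`: tensoring with `{∅, {⋆}}` -/

/-- The two-member family `{∅, {⋆}}` on `Unit` has difference set `{∅, {⋆}}` and the left kernel vector `(1, −1)` at `θ = 1`
(and `(1, 1)` at `θ = −1`). -/
theorem pencil_dependency_signFlip (s : K) (hs : s * s = 1) :
    ∀ E ∈ ({∅, {()}} : Finset (Finset Unit)) \\ ({∅, {()}} : Finset (Finset Unit)),
      ∑ B ∈ ({∅, {()}} : Finset (Finset Unit)), (if B = ∅ then (1 : K) else -s) *
        ((if E ⊆ B then (1 : K) else 0) + s * (if Disjoint E B then (1 : K) else 0)) = 0 := by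
  intro E hE
  have hne : (∅ : Finset Unit) ≠ {()} := (singleton_ne_empty ()).symm
  rw [sum_pair hne]
  have hE' : E = ∅ ∨ E = {()} := by
    rcases Finset.eq_empty_or_nonempty E with h | ⟨u, hu⟩
    · exact Or.inl h
    · exact Or.inr (by ext x; cases x; cases u; simpa using hu)
  rcases hE' with rfl | rfl
  · rw [if_pos rfl, if_neg hne.symm, if_pos (empty_subset _), if_pos (empty_subset _),
      if_pos (disjoint_empty_left _), if_pos (disjoint_empty_left _)]
    linear_combination (-1 : K) * hs
  · have e1 : ¬ (({()} : Finset Unit) ⊆ ∅) := by simp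
    have e4 : ¬ Disjoint (({()} : Finset Unit)) {()} := by simp
    rw [if_pos rfl, if_neg hne.symm, if_neg e1, if_pos subset_rfl, if_pos (disjoint_empty_right _), if_neg e4]
    ring

/-- **Dependency at `t` ⟹ dependency at `−t` for the product with `{∅, {⋆}}`.** -/
theorem pencil_dependency_neg (𝒜 : Finset (Finset α)) (c : Finset α → K) {t : K}
    (hc : ∀ E ∈ 𝒜 \\ 𝒜, ∑ A ∈ 𝒜, c A * ((if E ⊆ A then (1 : K) else 0) + t * (if Disjoint E A then (1 : K) else 0)) = 0) :
    ∀ E ∈ ((𝒜 ×ˢ ({∅, {()}} : Finset (Finset Unit))).image (fun p => p.1.disjSum p.2)) \\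
        ((𝒜 ×ˢ ({∅, {()}} : Finset (Finset Unit))).image (fun p => p.1.disjSum p.2)),
      ∑ P ∈ (𝒜 ×ˢ ({∅, {()}} : Finset (Finset Unit))).image (fun p => p.1.disjSum p.2),
        (c P.toLeft * (if P.toRight = ∅ then (1 : K) else -1)) *
        ((if E ⊆ P then (1 : K) else 0) + (-t) * (if Disjoint E P then (1 : K) else 0)) = 0 := by
  have h := pencil_dependency_prod 𝒜 ({∅, {()}} : Finset (Finset Unit)) c (fun B => if B = ∅ then (1 : K) else -1)
    (θ₁ := t) (θ₂ := 1) hc (by simpa using pencil_dependency_signFlip (K := K) 1 (by ring))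
  simpa using h

/-- **(C0) at `t` for all families ⟺ (C0) at `−t` for all families.**  If the pencil rows of some family `𝒜` on `α` are linearly
dependent at `t`, then the pencil rows of the family `𝒜 ⊗ {∅, {⋆}}` on `α ⊕ Unit` are linearly dependent at `−t`. -/
theorem not_linearIndependent_pencil_neg_of_not_linearIndependent (𝒜 : Finset (Finset α)) {t : K}
    (h : ¬ LinearIndependent K (fun A : 𝒜 => fun E : (𝒜 \\ 𝒜 : Finset (Finset α)) =>
      (if (E : Finset α) ⊆ (A : Finset α) then (1 : K) else 0) +
        t * (if Disjoint (E : Finset α) (A : Finset α) then (1 : K) else 0))) :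
    ¬ LinearIndependent K (fun P : ((𝒜 ×ˢ ({∅, {()}} : Finset (Finset Unit))).image (fun p => p.1.disjSum p.2)) =>
      fun E : ((((𝒜 ×ˢ ({∅, {()}} : Finset (Finset Unit))).image (fun p => p.1.disjSum p.2)) \\
          ((𝒜 ×ˢ ({∅, {()}} : Finset (Finset Unit))).image (fun p => p.1.disjSum p.2))) : Finset (Finset (α ⊕ Unit))) =>
      (if (E : Finset (α ⊕ Unit)) ⊆ (P : Finset (α ⊕ Unit)) then (1 : K) else 0) +
        (-t) * (if Disjoint (E : Finset (α ⊕ Unit)) (P : Finset (α ⊕ Unit)) then (1 : K) else 0)) := by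
  classical
  set PF := (𝒜 ×ˢ ({∅, {()}} : Finset (Finset Unit))).image (fun p => p.1.disjSum p.2) with hPF
  rw [Fintype.not_linearIndependent_iff] at h ⊢
  obtain ⟨g, hg, ⟨A₀, hA₀⟩⟩ := h
  -- total extension of `g`
  let c : Finset α → K := fun A => if hA : A ∈ 𝒜 then g ⟨A, hA⟩ else 0
  have hcg : ∀ A : 𝒜, c A = g A := fun A => by simp [c, A.2]
  have hc : ∀ E ∈ 𝒜 \\ 𝒜, ∑ A ∈ 𝒜, c A * ((if E ⊆ A then (1 : K) else 0) +
      t * (if Disjoint E A then (1 : K) else 0)) = 0 := by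
    intro E hE
    have h1 := congr_fun hg ⟨E, hE⟩
    simp only [Finset.sum_apply, Pi.smul_apply, smul_eq_mul, Pi.zero_apply] at h1
    rw [← sum_coe_sort 𝒜]
    simpa [hcg] using h1
  have hdep := pencil_dependency_neg 𝒜 c hc
  refine ⟨fun P => c (P : Finset (α ⊕ Unit)).toLeft * (if (P : Finset (α ⊕ Unit)).toRight = ∅ then (1 : K) else -1), ?_, ?_⟩
  · funext E
    simp only [Finset.sum_apply, Pi.smul_apply, smul_eq_mul, Pi.zero_apply]
    have h1 := hdep E E.2
    rw [← sum_coe_sort PF] at h1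
    exact h1
  · refine ⟨⟨(A₀ : Finset α).disjSum ∅, mem_image.mpr ⟨((A₀ : Finset α), ∅), mem_product.mpr ⟨A₀.2, by simp⟩, rfl⟩⟩, ?_⟩
    simp only [toLeft_disjSum, toRight_disjSum, if_true, mul_one, hcg]
    exact hA₀

/-! ### Complementation `t ↦ t⁻¹` and the reduction of CONJECTURE J to `θ = −1` -/

/-- The complemented family `{S \ A : A ∈ 𝒜}` (all members of `𝒜` inside `S`) has the same difference set as `𝒜`. -/
theorem diffs_compl_eq (𝒜 : Finset (Finset α)) (S : Finset α) (hS : ∀ A ∈ 𝒜, A ⊆ S) :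
    (𝒜.image (S \ ·)) \\ (𝒜.image (S \ ·)) = 𝒜 \\ 𝒜 := by
  have key : ∀ A ∈ 𝒜, ∀ B ∈ 𝒜, (S \ A) \ (S \ B) = B \ A := by
    intro A _ B hB
    ext x
    simp only [mem_sdiff, not_and, not_not]
    constructor
    · rintro ⟨⟨hxS, hxA⟩, h2⟩
      exact ⟨h2 hxS, hxA⟩
    · rintro ⟨hxB, hxA⟩
      exact ⟨⟨hS B hB hxB, hxA⟩, fun _ => hxB⟩
  ext E
  simp only [mem_diffs, mem_image]
  constructor
  · rintro ⟨_, ⟨A, hA, rfl⟩, _, ⟨B, hB, rfl⟩, rfl⟩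
    exact ⟨B, hB, A, hA, (key A hA B hB).symm⟩
  · rintro ⟨B, hB, A, hA, rfl⟩
    exact ⟨S \ A, ⟨A, hA, rfl⟩, S \ B, ⟨B, hB, rfl⟩, key A hA B hB⟩

/-- **Complementation inverts the eigenvalue.**  If `c` is a left kernel vector of the pencil of `𝒜` at `θ ≠ 0` (all members inside
`S`), then `C ↦ c (S \ C)` is a left kernel vector of the pencil of the complemented family `{S \ A}` at `θ⁻¹`
[`[E ⊆ S \ A] = [E ∩ A = ∅]` and `[E ∩ (S \ A) = ∅] = [E ⊆ A]` for `E ⊆ S`]. -/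
theorem pencil_dependency_compl (𝒜 : Finset (Finset α)) (S : Finset α) (hS : ∀ A ∈ 𝒜, A ⊆ S) (c : Finset α → K)
    {θ : K} (hθ : θ ≠ 0)
    (hc : ∀ E ∈ 𝒜 \\ 𝒜, ∑ A ∈ 𝒜, c A * ((if E ⊆ A then (1 : K) else 0) + θ * (if Disjoint E A then (1 : K) else 0)) = 0) :
    ∀ E ∈ (𝒜.image (S \ ·)) \\ (𝒜.image (S \ ·)), ∑ C ∈ 𝒜.image (S \ ·), c (S \ C) *
      ((if E ⊆ C then (1 : K) else 0) + θ⁻¹ * (if Disjoint E C then (1 : K) else 0)) = 0 := by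
  rw [diffs_compl_eq 𝒜 S hS]
  intro E hE
  have hES : E ⊆ S := diffs_subset_of_subset 𝒜 S hS E hE
  have hinj : Set.InjOn (fun A : Finset α => S \ A) 𝒜 := by
    intro A hA B hB h
    have e : S \ (S \ A) = S \ (S \ B) := congrArg (S \ ·) h
    rwa [Finset.sdiff_sdiff_eq_self (hS A hA), Finset.sdiff_sdiff_eq_self (hS B hB)] at e
  rw [sum_image hinj]
  have e : ∑ A ∈ 𝒜, c (S \ (S \ A)) * ((if E ⊆ S \ A then (1 : K) else 0) + θ⁻¹ * (if Disjoint E (S \ A) then (1 : K) else 0)) =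
      θ⁻¹ * ∑ A ∈ 𝒜, c A * ((if E ⊆ A then (1 : K) else 0) + θ * (if Disjoint E A then (1 : K) else 0)) := by
    rw [mul_sum]
    refine sum_congr rfl fun A hA => ?_
    obtain ⟨h1, h2⟩ := subset_compl_iff_and_disjoint_compl_iff S A E hES
    rw [Finset.sdiff_sdiff_eq_self (hS A hA)]
    simp only [h1, h2]
    field_simp
    ring
  rw [e, hc E hE, mul_zero]

/-- **CONJECTURE J reduces to `θ = −1`.**  A left Jordan chain `(c₀, c₁)` of length two at any `θ ≠ 0` for a family `𝒜` (members
inside `S`) produces the left Jordan chain `(c₀ ⊗ c̃₀, −θ • c₁ ⊗ c̃₀)` of length two at `θ = −1` for the product family `𝒜 ⊗ 𝒜ᶜ` on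
`α ⊕ α`, where `𝒜ᶜ = {S \ A}` and `c̃₀ (S \ A) = c₀ A` [`pencil_dependency_compl` + `pencil_chain_prod` with `θ₂ = θ⁻¹`].  So 'no Jordan
chain at `−1` for every family' implies 'no Jordan chain at any `θ`, for every family', over any field. -/
theorem pencil_chain_neg_one_of_chain (𝒜 : Finset (Finset α)) (S : Finset α) (hS : ∀ A ∈ 𝒜, A ⊆ S) (c₀ c₁ : Finset α → K)
    {θ : K} (hθ : θ ≠ 0)
    (hc₀ : ∀ E ∈ 𝒜 \\ 𝒜, ∑ A ∈ 𝒜, c₀ A * ((if E ⊆ A then (1 : K) else 0) + θ * (if Disjoint E A then (1 : K) else 0)) = 0)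
    (hc₁ : ∀ E ∈ 𝒜 \\ 𝒜, ∑ A ∈ 𝒜, (c₁ A * ((if E ⊆ A then (1 : K) else 0) + θ * (if Disjoint E A then (1 : K) else 0)) +
      c₀ A * (if Disjoint E A then (1 : K) else 0)) = 0) :
    (∀ E ∈ ((𝒜 ×ˢ 𝒜.image (S \ ·)).image (fun p => p.1.disjSum p.2)) \\ ((𝒜 ×ˢ 𝒜.image (S \ ·)).image (fun p => p.1.disjSum p.2)),
      ∑ P ∈ (𝒜 ×ˢ 𝒜.image (S \ ·)).image (fun p => p.1.disjSum p.2), (c₀ P.toLeft * c₀ (S \ P.toRight)) *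
        ((if E ⊆ P then (1 : K) else 0) + (-1) * (if Disjoint E P then (1 : K) else 0)) = 0) ∧
    (∀ E ∈ ((𝒜 ×ˢ 𝒜.image (S \ ·)).image (fun p => p.1.disjSum p.2)) \\ ((𝒜 ×ˢ 𝒜.image (S \ ·)).image (fun p => p.1.disjSum p.2)),
      ∑ P ∈ (𝒜 ×ˢ 𝒜.image (S \ ·)).image (fun p => p.1.disjSum p.2),
        ((-θ * (c₁ P.toLeft * c₀ (S \ P.toRight))) *
          ((if E ⊆ P then (1 : K) else 0) + (-1) * (if Disjoint E P then (1 : K) else 0)) +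
        (c₀ P.toLeft * c₀ (S \ P.toRight)) * (if Disjoint E P then (1 : K) else 0)) = 0) := by
  have hd := pencil_dependency_compl 𝒜 S hS c₀ hθ hc₀
  have h := pencil_chain_prod 𝒜 (𝒜.image (S \ ·)) c₀ c₁ (fun C => c₀ (S \ C)) (θ₁ := θ) (θ₂ := θ⁻¹)
    (inv_ne_zero hθ) hc₀ hc₁ hd
  have e1 : -(θ * θ⁻¹) = (-1 : K) := by rw [mul_inv_cancel₀ hθ]
  have e2 : -θ⁻¹⁻¹ = -θ := by rw [inv_inv]
  rw [e1, e2] at h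
  exact h

end OrderedDifferences

end Summit.CriticalPhenomena.PercolationContinuityZ3.Theorems
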